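/-
Public-domain reproduction (cell pub-lg7, seat 4 = literature).  Heath-Brown–Puchta 2002, §5: the "easy exercise" closed form
for the residue count `H(d; N, K)` at the moduli `d` modulo which `2` is a primitive root, and the PRINTED major-arc
singular-series constant `2 Σ_{d ≤ 5} k(d) H(d; N, K) ε(d)^{-K} ≥ 2.7895` for EVERY `K ≥ 7` and every `N` — as theorems about
the tree's quantities `resCount` / `minResCount` / `mKD` of `GoldbachLinnikDirectMean` (seat 5).  Plus CONCLUSION-FORM kernel
certificates for the two other printed instances of the same truncated mean (Liu–Lü 2011: `2.8096` with `D = 11`; Elsholtz,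
as reported in Heath-Brown–Puchta §1: `2.96169` with `D = 21`) at every `K ≥ 12`.  No new mathematics.  THIS FILE IS NOT A
ROUTE TO GOLDBACH; no value of `K` is claimed or lowered here (published record: `K = 8`, Pintz–Ruzsa 2020; the constants
below served the Heath-Brown–Puchta-line records `K = 13` and `K = 12`).
-/
import Literature.NumberTheory.Sieve.GoldbachLinnikDirectCertifiedInputs
import Literature.NumberTheory.Sieve.GoldbachLinnikHBPCriterion
import HarnessLib

/-!
# Heath-Brown–Puchta's major-arc constant `2.7895` (`D = 5`) and the closed form of `H(d; N, K)` — in the kernel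

Topic `Literature/NumberTheory/Sieve` (additive problems with primes and powers of `2`).  Sequel to
`GoldbachLinnikDirectMean.lean` / `GoldbachLinnikDirectMeanCert.lean` / `GoldbachLinnikDirectCertified.lean` (seat 5 of cell
`pub-lg7`: `resCount d K r = #{e ∈ [1, ξ(d)]^K : Σ 2^{eᵢ} ≡ r (mod d)}` = Heath-Brown–Puchta's `H(d; N, K)` at `N ≡ r`,
`minResCount d K = min_r resCount d K r`, `mKD K D = C₀ Σ_{1 ≤ d ≤ D} k(d) minResCount d K / ξ(d)^K`, the certificate
format `certOK` and its soundness `certSum_le_sum`, and the kernel value `Σ_{d ≤ 105} ⋯ ≥ 1.49978` at `K = 7`).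
**NOT A ROUTE TO GOLDBACH; no `K` is claimed.**

D. R. Heath-Brown and J.-C. Puchta, *Integers represented as a sum of primes and powers of two*, Asian J. Math. **6**
(2002) 535–565, §5 (arXiv:math/0201299, p. 6 of the source), verbatim:

> "We shall take `D = 5`.  We trivially have `ε(1) = 1` and `H(1;N,K) = 1` for all `N` and `K`.  When `d = 3` or `d = 5`
> the powers of `2` run over all non-zero residues modulo `d`, and it is an easy exercise to check that
> `H(d;N,K) = (1/d){(d−1)^K − (−1)^K}` (`d ∤ N`), `= (1/d){(d−1)^K + (−1)^K (d−1)}` (`d ∣ N`).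
> Thus if `K ≥ 7` we have `H(3;N,K) ε(3)^{−K} ≥ (1/3)(1 − 2^{−6})` and `H(5;N,K) ε(5)^{−K} ≥ (1/5)(1 − 4^{−6})`, whence
> `2 Σ_{d ≤ D} k(d) H(d;N,K) ε(d)^{−K} ≥ 2.7895` for any choice of `N`."

This is the constant of their (25) (`Σ₀ ≥ 2.7895(1−2ϖ)C₀N(log N)^{−2}L^K`) and of the final inequality
`13.968 λ^{K−2} < 2.7895` of their §6 (tree: `GoldbachLinnik.hbp_criterion_thirteen`, `…_GRH_seven`, where `2.7895` is a
literal).  This file PROVES: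

* §1 (the easy exercise, for every modulus `d ≥ 2` with `ord_d 2 = d − 1`): the recursion
  `resCount d (K+1) r + resCount d K r = (d−1)^K` (`resCount_succ_add_of_ord2`), the closed form
  `d · resCount d K r = (d−1)^K + (−1)^K · (d·[r = 0] − 1)` over `ℤ` (`resCount_closedForm`), its two printed cases over `ℚ`
  (`resCount_eq_of_dvd` / `resCount_eq_of_not_dvd`), and the uniform lower bound `d · resCount d K r ≥ (d−1)^K − (d−1)`;
* §2 (the printed constant): `ord₃ 2 = 2`, `ord₅ 2 = 4`, the two displayed bounds at `K ≥ 7`, the `d = 1` term, and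
  **`two_mul_singularMeanSum_five_ge`: `2.7895 ≤ 2 Σ_{1≤d≤5} k(d) minResCount d K / ξ(d)^K` for every `K ≥ 7`** (exact value
  of the Heath-Brown–Puchta minorant: `5713/2048 = 2.78955078125`), the same for every `D ≥ 5` (terms are `≥ 0`), the
  consequence `mKD K D ≥ 0.918` (`K ≥ 7`, `D ≥ 5`, with the tree's `C₀ ≥ 0.65828`), and the hypothesis `2.7895 ≤ C₃` of
  `hbp_criterion_of_thirteen_le` DISCHARGED by the defined quantity (`hbp_criterion_thirteen_definedMean`,
  `hbp_criterion_GRH_seven_definedMean`);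
* §3 (comparators in conclusion form, kernel certificates in seat 5's format at `K = 12`, monotonicity in `K` from
  `GoldbachLinnikDirectCertifiedInputs`): `2 Σ_{d≤11} ⋯ ≥ 2.877166 ≥ 2.8096` (the constant Platt–Trudgian §1 attribute to
  Liu–Lü 2011 with `D = 11`) and `2 Σ_{d≤21} ⋯ ≥ 2.968604 ≥ 2.96169` (Elsholtz's `D = 21` constant reported in
  Heath-Brown–Puchta §1) for every `K ≥ 12`; the printed values are thus VALID lower bounds of the tree's quantity at the `K`
  where they were used (their own derivations — Liu–Lü's text, Elsholtz's unpublished manuscript — are not held by the cell and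
  are not reproduced; nothing is asserted about them beyond these inequalities).

Numerical cross-check (cell `pub-lg7`, exact rational arithmetic; two independent implementations — this seat's
`g14/hbp5/smean.py` and ENGINE A's `e11_pt_c3adm` "V0" column of REPRODUCE.md §E11-A, which agree at all six common rows
`(D, K) ∈ {5, 11, 21} × {6, 11}`): writing `2S(K,D)` for twice the sum certified here, `2S(6,5) = 2S(7,5) = 2.78955078125`
(the printed minorant is attained), `2S(12,11) = 2.8771669480…`, `2S(12,21) = 2.9686058128…`, `2S(11,21) = 2.9679966708…`;
the printed `2.8096` and `2.96169` are therefore valid but not sharp for this quantity (REPRODUCE.md §E28).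

## References

* D. R. Heath-Brown, J.-C. Puchta, *Integers represented as a sum of primes and powers of two*, Asian J. Math. 6 (2002)
  535–565 (arXiv:math/0201299): §5, the display after (22) through (25); §1 (Elsholtz's `D = 21`, `2.96169`); §6.
  [HeathbrownPuchta2002]
* D. J. Platt, T. S. Trudgian, *Linnik's approximation to Goldbach's conjecture, and other problems*, J. Number Theory 153
  (2015) 54–62: §1 (Liu–Lü's `C₃ ≥ 2.8096` with `D = 11`; Elsholtz's `2.96169`). [PlattTrudgian2015Linnik]
* Z. Liu, G. Lü, *Density of two squares of primes and powers of 2*, Int. J. Number Theory 7 (2011) 1317–1329 (the `K = 12`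
  paper as cited by Platt–Trudgian; text not held by the cell — conclusion form only). [LiuLu2011]
-/

open Finset

namespace Literature.NumberTheory.Sieve

namespace GoldbachLinnik

open SingularSeriesMean

/-! ### §1 Heath-Brown–Puchta's "easy exercise": the residue count when `2` is a primitive root -/

section ClosedForm

variable {d : ℕ}

/-- Translation invariance: `Σ_{x mod d} resCount d K (r − x) = Σ_{y mod d} resCount d K y`. [folklore] -/
theorem sum_resCount_sub [NeZero d] (K : ℕ) (r : ZMod d) :
    ∑ x : ZMod d, resCount d K (r - x) = ∑ y : ZMod d, resCount d K y :=
  Equiv.sum_comp (Equiv.subLeft r) (fun y => resCount d K y)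

/-- The total count: `Σ_{r mod d} resCount d K r = ξ(d)^K` (every tuple has exactly one residue). [folklore] -/
theorem sum_resCount_eq_pow [NeZero d] (K : ℕ) : ∑ r : ZMod d, resCount d K r = ord2 d ^ K := by
  induction K with
  | zero =>
    simp only [resCount_zero, pow_zero]
    rw [Finset.sum_ite_eq' Finset.univ (0 : ZMod d) (fun _ => 1)]
    simp
  | succ K ih =>
    simp only [resCount_succ]
    rw [Finset.sum_comm]
    have h : ∀ e ∈ Finset.range (ord2 d),
        ∑ r : ZMod d, resCount d K (r - 2 ^ (e + 1)) = ord2 d ^ K := by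
      intro e _
      rw [← ih]
      exact Equiv.sum_comp (Equiv.subRight ((2 : ZMod d) ^ (e + 1))) (fun y => resCount d K y)
    rw [Finset.sum_congr rfl h, Finset.sum_const, Finset.card_range, smul_eq_mul, pow_succ, mul_comm]

/-- When `ord_d 2 = d − 1` (`d ≥ 2`), the powers `2¹, …, 2^{d−1}` are exactly the non-zero residues modulo `d`
("the powers of `2` run over all non-zero residues modulo `d`"). [cite: HeathbrownPuchta2002, §5 (d = 3, 5)] -/
theorem image_two_pow_eq_erase_zero (hd : 2 ≤ d) (hord : ord2 d = d - 1) :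
    haveI : NeZero d := ⟨by omega⟩
    (Finset.range (d - 1)).image (fun e => (2 : ZMod d) ^ (e + 1)) = (Finset.univ : Finset (ZMod d)).erase 0 := by
  haveI : NeZero d := ⟨by omega⟩
  haveI : Fact (1 < d) := ⟨by omega⟩
  have hordZ : orderOf (2 : ZMod d) = d - 1 := hord
  have hfin : IsOfFinOrder (2 : ZMod d) := orderOf_pos_iff.1 (by rw [hordZ]; omega)
  have hunit : IsUnit (2 : ZMod d) := hfin.isUnit
  have hinj : Set.InjOn (fun e => (2 : ZMod d) ^ (e + 1)) (Finset.range (d - 1) : Set ℕ) := by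
    intro e₁ he₁ e₂ he₂ heq
    simp only [Finset.coe_range, Set.mem_Iio] at he₁ he₂
    have heq' : (2 : ZMod d) ^ e₁ * 2 = (2 : ZMod d) ^ e₂ * 2 := by
      simpa only [pow_succ] using heq
    have heq'' : (2 : ZMod d) ^ e₁ = (2 : ZMod d) ^ e₂ := hunit.mul_right_cancel heq'
    exact pow_injOn_Iio_orderOf (by rw [Set.mem_Iio, hordZ]; exact he₁) (by rw [Set.mem_Iio, hordZ]; exact he₂) heq''
  have hsub : (Finset.range (d - 1)).image (fun e => (2 : ZMod d) ^ (e + 1)) ⊆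
      (Finset.univ : Finset (ZMod d)).erase 0 := by
    intro x hx
    rw [Finset.mem_image] at hx
    obtain ⟨e, -, rfl⟩ := hx
    exact Finset.mem_erase.2 ⟨(hunit.pow (e + 1)).ne_zero, Finset.mem_univ _⟩
  refine Finset.eq_of_subset_of_card_le hsub ?_
  rw [Finset.card_image_of_injOn hinj, Finset.card_range, Finset.card_erase_of_mem (Finset.mem_univ _),
    Finset.card_univ, ZMod.card]

/-- **The recursion behind the easy exercise.**  If `ord_d 2 = d − 1` (`d ≥ 2`) then for every `K` and `r`,
`resCount d (K+1) r + resCount d K r = (d − 1)^K`: a `(K+1)`-tuple with sum `≡ r` is a `K`-tuple with sum `≡ r − x`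
for a NON-ZERO `x`, and the `K`-tuples of all residues number `(d−1)^K`. [cite: HeathbrownPuchta2002, §5] -/
theorem resCount_succ_add_of_ord2 (hd : 2 ≤ d) (hord : ord2 d = d - 1) (K : ℕ) (r : ZMod d) :
    resCount d (K + 1) r + resCount d K r = (d - 1) ^ K := by
  haveI : NeZero d := ⟨by omega⟩
  have himg := image_two_pow_eq_erase_zero hd hord
  have hinj : Set.InjOn (fun e => (2 : ZMod d) ^ (e + 1)) (Finset.range (d - 1) : Set ℕ) := by
    rw [← Finset.card_image_iff, himg, Finset.card_erase_of_mem (Finset.mem_univ _), Finset.card_univ, ZMod.card,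
      Finset.card_range]
  have h1 : resCount d (K + 1) r = ∑ x ∈ (Finset.univ : Finset (ZMod d)).erase 0, resCount d K (r - x) := by
    rw [resCount_succ, hord, ← himg, Finset.sum_image hinj]
  have h2 : ∑ x ∈ (Finset.univ : Finset (ZMod d)).erase 0, resCount d K (r - x) + resCount d K (r - 0) =
      ∑ x : ZMod d, resCount d K (r - x) := Finset.sum_erase_add _ _ (Finset.mem_univ _)
  rw [sub_zero] at h2
  rw [h1, h2, sum_resCount_sub, sum_resCount_eq_pow, hord]

/-- **Heath-Brown–Puchta's closed form** (over `ℤ`): if `ord_d 2 = d − 1` (`d ≥ 2`) then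
`d · resCount d K r = (d−1)^K + (−1)^K · (d − 1)` for `r = 0` and `= (d−1)^K − (−1)^K` for `r ≠ 0`.
[cite: HeathbrownPuchta2002, §5 ("it is an easy exercise to check that …")] -/
theorem resCount_closedForm (hd : 2 ≤ d) (hord : ord2 d = d - 1) (K : ℕ) (r : ZMod d) :
    (d : ℤ) * (resCount d K r : ℤ) = ((d : ℤ) - 1) ^ K + (-1) ^ K * (if r = 0 then (d : ℤ) - 1 else -1) := by
  haveI : NeZero d := ⟨by omega⟩
  induction K with
  | zero =>
    rw [resCount_zero]
    by_cases hr : r = 0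
    · rw [if_pos hr, if_pos hr]; push_cast; ring
    · rw [if_neg hr, if_neg hr]; push_cast; ring
  | succ K ih =>
    have hrec := resCount_succ_add_of_ord2 hd hord K r
    have hrecZ : (resCount d (K + 1) r : ℤ) = ((d : ℤ) - 1) ^ K - (resCount d K r : ℤ) := by
      have := congrArg (fun n : ℕ => (n : ℤ)) hrec
      push_cast [Nat.cast_sub (by omega : 1 ≤ d)] at this
      linarith
    rw [hrecZ, mul_sub, ih]
    ring

/-- The printed case `d ∣ N` (i.e. `r = 0`): `H(d;N,K) = (1/d){(d−1)^K + (−1)^K (d−1)}`.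
[cite: HeathbrownPuchta2002, §5 display (d ∣ N)] -/
theorem resCount_eq_of_dvd (hd : 2 ≤ d) (hord : ord2 d = d - 1) (K : ℕ) :
    (resCount d K (0 : ZMod d) : ℚ) = (((d : ℚ) - 1) ^ K + (-1) ^ K * ((d : ℚ) - 1)) / d := by
  have h := resCount_closedForm hd hord K (0 : ZMod d)
  rw [if_pos rfl] at h
  have hq : (d : ℚ) * (resCount d K (0 : ZMod d) : ℚ) = ((d : ℚ) - 1) ^ K + (-1) ^ K * ((d : ℚ) - 1) := by
    exact_mod_cast h
  have hd0 : (d : ℚ) ≠ 0 := by exact_mod_cast (show d ≠ 0 by omega)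
  rw [eq_div_iff hd0, mul_comm]
  exact hq

/-- The printed case `d ∤ N` (i.e. `r ≠ 0`): `H(d;N,K) = (1/d){(d−1)^K − (−1)^K}`.
[cite: HeathbrownPuchta2002, §5 display (d ∤ N)] -/
theorem resCount_eq_of_not_dvd (hd : 2 ≤ d) (hord : ord2 d = d - 1) (K : ℕ) {r : ZMod d} (hr : r ≠ 0) :
    (resCount d K r : ℚ) = (((d : ℚ) - 1) ^ K - (-1) ^ K) / d := by
  have h := resCount_closedForm hd hord K r
  rw [if_neg hr] at h
  have hq : (d : ℚ) * (resCount d K r : ℚ) = ((d : ℚ) - 1) ^ K - (-1) ^ K := by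
    have : (d : ℤ) * (resCount d K r : ℤ) = ((d : ℤ) - 1) ^ K - (-1) ^ K := by rw [h]; ring
    exact_mod_cast this
  have hd0 : (d : ℚ) ≠ 0 := by exact_mod_cast (show d ≠ 0 by omega)
  rw [eq_div_iff hd0, mul_comm]
  exact hq

/-- Uniform lower bound: `d · resCount d K r ≥ (d−1)^K − (d−1)` for every residue `r` (the worst case is `d ∣ N`, `K` odd).
[cite: HeathbrownPuchta2002, §5] -/
theorem sub_le_mul_resCount (hd : 2 ≤ d) (hord : ord2 d = d - 1) (K : ℕ) (r : ZMod d) :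
    ((d : ℝ) - 1) ^ K - ((d : ℝ) - 1) ≤ (d : ℝ) * (resCount d K r : ℝ) := by
  have h := resCount_closedForm hd hord K r
  have hR : (d : ℝ) * (resCount d K r : ℝ) =
      ((d : ℝ) - 1) ^ K + (-1) ^ K * (if r = 0 then (d : ℝ) - 1 else -1) := by
    have h' := congrArg (fun z : ℤ => (z : ℝ)) h
    push_cast at h'
    rw [h']
  rw [hR]
  have hd1 : (1 : ℝ) ≤ (d : ℝ) - 1 := by
    have : (2 : ℝ) ≤ d := by exact_mod_cast hd
    linarith
  rcases neg_one_pow_eq_or ℝ K with hK | hK <;> rw [hK] <;> split_ifs <;> linarith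

/-- The minimum over residues inherits the bound: `(d−1)^K − (d−1) ≤ d · minResCount d K`.
[cite: HeathbrownPuchta2002, §5] -/
theorem sub_le_mul_minResCount (hd : 2 ≤ d) (hord : ord2 d = d - 1) (K : ℕ) :
    ((d : ℝ) - 1) ^ K - ((d : ℝ) - 1) ≤ (d : ℝ) * (minResCount d K : ℝ) := by
  have hd0 : d ≠ 0 := by omega
  obtain ⟨r₀, -, hr₀⟩ := Finset.exists_mem_eq_inf' (Finset.nonempty_range_iff.2 hd0)
    (fun r : ℕ => resCount d K (r : ZMod d))
  have hmin : minResCount d K = resCount d K ((r₀ : ℕ) : ZMod d) := by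
    rw [minResCount, dif_neg hd0]; exact hr₀
  rw [hmin]
  exact sub_le_mul_resCount hd hord K _

end ClosedForm

/-! ### §2 The printed constant: `2 Σ_{d ≤ 5} k(d) H(d;N,K) ε(d)^{−K} ≥ 2.7895` for every `K ≥ 7` -/

/-- `ε(1) = 1`. [cite: HeathbrownPuchta2002, §5 ("We trivially have ε(1) = 1")] -/
theorem ord2_one : ord2 1 = 1 := ord2_eq_of_cert (by decide)

/-- `ε(3) = 2`. [cite: HeathbrownPuchta2002, §5] -/
theorem ord2_three : ord2 3 = 2 := ord2_eq_of_cert (by decide)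

/-- `ε(5) = 4`. [cite: HeathbrownPuchta2002, §5] -/
theorem ord2_five : ord2 5 = 4 := ord2_eq_of_cert (by decide)

/-- `H(1;N,K) = 1`: modulo `1` every tuple counts, and there is exactly one tuple in `[1,1]^K`.
[cite: HeathbrownPuchta2002, §5 ("H(1;N,K) = 1 for all N and K")] -/
theorem resCount_one (K : ℕ) (r : ZMod 1) : resCount 1 K r = 1 := by
  haveI : Subsingleton (ZMod 1) := inferInstanceAs (Subsingleton (Fin 1))
  rw [resCount, ord2_one, Finset.filter_true_of_mem (fun e _ => Subsingleton.elim _ _), card_expTuplesL, one_pow]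

/-- `min_N H(1;N,K) = 1`. [cite: HeathbrownPuchta2002, §5] -/
theorem minResCount_one (K : ℕ) : minResCount 1 K = 1 := by
  rw [minResCount, dif_neg one_ne_zero]
  have h : Finset.range 1 = {0} := Finset.range_one
  simp only [h, Finset.inf'_singleton, resCount_one]

/-- `k(1) = 1`. [folklore] -/
theorem fq_one_one : fq 1 1 = 1 := by
  have h := fq_one_list_prod [] (by simp) List.nodup_nil
  simpa [invProdR] using h

/-- `k(3) = 1`. [cite: HeathbrownPuchta2002, §4 (21) (k(p) = (p−2)^{-1})] -/
theorem fq_one_three : fq 1 3 = 1 := by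
  have h := fq_one_list_prod [3] (by norm_num) (List.nodup_singleton 3)
  norm_num [invProdR] at h
  exact h

/-- `k(5) = 1/3`. [cite: HeathbrownPuchta2002, §4 (21)] -/
theorem fq_one_five : fq 1 5 = 1 / 3 := by
  have h := fq_one_list_prod [5] (by norm_num) (List.nodup_singleton 5)
  norm_num [invProdR] at h
  exact h

/-- The `d = 1` term of the truncated mean is `1`. [cite: HeathbrownPuchta2002, §5] -/
theorem term_one_eq (K : ℕ) : fq 1 1 * ((minResCount 1 K : ℝ) / (ord2 1 : ℝ) ^ K) = 1 := by
  rw [fq_one_one, minResCount_one, ord2_one]; simp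

/-- **Printed bound at `d = 3`**: "if `K ≥ 7` we have `H(3;N,K) ε(3)^{−K} ≥ (1/3)(1 − 2^{−6})`" (`= 21/64`).
[cite: HeathbrownPuchta2002, §5] -/
theorem term_three_ge {K : ℕ} (hK : 7 ≤ K) :
    (1 / 3 * (1 - 1 / 2 ^ 6) : ℝ) ≤ fq 1 3 * ((minResCount 3 K : ℝ) / (ord2 3 : ℝ) ^ K) := by
  rw [fq_one_three, ord2_three, one_mul]
  have h := sub_le_mul_minResCount (d := 3) (by norm_num) (by rw [ord2_three]) K
  push_cast at h
  norm_num at h ⊢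
  have h2K : (2 : ℝ) ^ 7 ≤ 2 ^ K := pow_le_pow_right₀ (by norm_num) hK
  rw [le_div_iff₀ (by positivity)]
  nlinarith

/-- **Printed bound at `d = 5`**: "`H(5;N,K) ε(5)^{−K} ≥ (1/5)(1 − 4^{−6})`" for `K ≥ 7`; with `k(5) = 1/3` the term is
`≥ (1/15)(1 − 4^{−6}) = 273/4096`. [cite: HeathbrownPuchta2002, §5] -/
theorem term_five_ge {K : ℕ} (hK : 7 ≤ K) :
    (1 / 3 * (1 / 5 * (1 - 1 / 4 ^ 6)) : ℝ) ≤ fq 1 5 * ((minResCount 5 K : ℝ) / (ord2 5 : ℝ) ^ K) := by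
  rw [fq_one_five, ord2_five]
  have h := sub_le_mul_minResCount (d := 5) (by norm_num) (by rw [ord2_five]) K
  push_cast at h
  norm_num at h ⊢
  have h4K : (4 : ℝ) ^ 7 ≤ 4 ^ K := pow_le_pow_right₀ (by norm_num) hK
  have h4pos : (0 : ℝ) < 4 ^ K := by positivity
  have key : (819 / 4096 : ℝ) * 4 ^ K ≤ (minResCount 5 K : ℝ) := by nlinarith
  have hdiv : (819 / 4096 : ℝ) ≤ (minResCount 5 K : ℝ) / 4 ^ K := by rw [le_div_iff₀ h4pos]; exact key
  linarith

/-- Every term of the truncated mean is `≥ 0`. [folklore] -/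
theorem singularMeanTerm_nonneg (K d : ℕ) : 0 ≤ fq 1 d * ((minResCount d K : ℝ) / (ord2 d : ℝ) ^ K) :=
  mul_nonneg (fq_nonneg 1 d) (by positivity)

/-- The truncated mean is monotone in the truncation `D` (all terms are `≥ 0`). [cite: HeathbrownPuchta2002, §5 ("for any fixed D")] -/
theorem singularMeanSum_mono {K D D' : ℕ} (hDD' : D ≤ D') :
    ∑ d ∈ Icc 1 D, fq 1 d * ((minResCount d K : ℝ) / (ord2 d : ℝ) ^ K) ≤
      ∑ d ∈ Icc 1 D', fq 1 d * ((minResCount d K : ℝ) / (ord2 d : ℝ) ^ K) :=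
  Finset.sum_le_sum_of_subset_of_nonneg (Finset.Icc_subset_Icc_right hDD') fun d _ _ => singularMeanTerm_nonneg K d

/-- The truncated mean is monotone in `K ≥ 1` (from `mKD_mono`, dividing by `C₀ > 0`).
[cite: HeathbrownPuchta2002, §4 (22)] -/
theorem singularMeanSum_mono_K {K K' D : ℕ} (hK : 1 ≤ K) (hKK' : K ≤ K') :
    ∑ d ∈ Icc 1 D, fq 1 d * ((minResCount d K : ℝ) / (ord2 d : ℝ) ^ K) ≤
      ∑ d ∈ Icc 1 D, fq 1 d * ((minResCount d K' : ℝ) / (ord2 d : ℝ) ^ K') := by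
  have h := mKD_mono hK hKK' D
  unfold mKD at h
  exact le_of_mul_le_mul_left h twinPrimeConst_pos_holds

/-- **The exact Heath-Brown–Puchta minorant**: for `K ≥ 7`,
`Σ_{1 ≤ d ≤ 5} k(d) minResCount d K / ξ(d)^K ≥ 1 + (1/3)(1 − 2^{−6}) + (1/15)(1 − 4^{−6}) = 5713/4096 = 1.39477539…`.
[cite: HeathbrownPuchta2002, §5] -/
theorem singularMeanSum_five_ge {K : ℕ} (hK : 7 ≤ K) :
    (5713 / 4096 : ℝ) ≤ ∑ d ∈ Icc 1 5, fq 1 d * ((minResCount d K : ℝ) / (ord2 d : ℝ) ^ K) := by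
  have hsub : ({1, 3, 5} : Finset ℕ) ⊆ Icc 1 5 := by decide
  have h135 : ∑ d ∈ ({1, 3, 5} : Finset ℕ), fq 1 d * ((minResCount d K : ℝ) / (ord2 d : ℝ) ^ K) =
      fq 1 1 * ((minResCount 1 K : ℝ) / (ord2 1 : ℝ) ^ K) + (fq 1 3 * ((minResCount 3 K : ℝ) / (ord2 3 : ℝ) ^ K) +
        fq 1 5 * ((minResCount 5 K : ℝ) / (ord2 5 : ℝ) ^ K)) := by
    rw [Finset.sum_insert (by decide), Finset.sum_insert (by decide), Finset.sum_singleton]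
  have hle := Finset.sum_le_sum_of_subset_of_nonneg hsub
    (fun d _ _ => singularMeanTerm_nonneg K d)
  rw [h135, term_one_eq] at hle
  have h3 := term_three_ge hK
  have h5 := term_five_ge hK
  have hnum : (5713 / 4096 : ℝ) = 1 + (1 / 3 * (1 - 1 / 2 ^ 6) + 1 / 3 * (1 / 5 * (1 - 1 / 4 ^ 6))) := by norm_num
  linarith

/-- **Heath-Brown–Puchta's printed constant, in the kernel**: for every `K ≥ 7` (and every `N`),
`2 Σ_{d ≤ 5} k(d) H(d;N,K) ε(d)^{−K} ≥ 2 Σ_{d ≤ 5} k(d) min_N H ε^{−K} ≥ 2.7895` (exactly `≥ 5713/2048 = 2.78955078125`).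
[cite: HeathbrownPuchta2002, §5, display before (25)] -/
theorem two_mul_singularMeanSum_five_ge {K : ℕ} (hK : 7 ≤ K) :
    (2.7895 : ℝ) ≤ 2 * ∑ d ∈ Icc 1 5, fq 1 d * ((minResCount d K : ℝ) / (ord2 d : ℝ) ^ K) := by
  have h := singularMeanSum_five_ge hK
  linarith

/-- The same for every truncation `D ≥ 5` (Heath-Brown–Puchta: "for any fixed `D` … We shall take `D = 5`").
[cite: HeathbrownPuchta2002, §5] -/
theorem two_mul_singularMeanSum_ge_of_five_le {K D : ℕ} (hK : 7 ≤ K) (hD : 5 ≤ D) :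
    (2.7895 : ℝ) ≤ 2 * ∑ d ∈ Icc 1 D, fq 1 d * ((minResCount d K : ℝ) / (ord2 d : ℝ) ^ K) :=
  (two_mul_singularMeanSum_five_ge hK).trans (by linarith [singularMeanSum_mono (K := K) hD])

/-- In the tree's normalisation: **`m_K(D) ≥ 0.918` for every `K ≥ 7` and `D ≥ 5`** (`5713/4096 · C₀` with the tree's
kernel bound `C₀ ≥ 0.65828`, `twinPrimeConst_ge`).  Weaker than the kernel certificate `m₇(105) ≥ 0.987` of
`GoldbachLinnikDirectCertified` but PRINTED and uniform in `K`. [cite: HeathbrownPuchta2002, §5, (25)] -/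
theorem mKD_ge_of_seven_le {K D : ℕ} (hK : 7 ≤ K) (hD : 5 ≤ D) : (0.918 : ℝ) ≤ mKD K D := by
  rw [mKD]
  have hC := twinPrimeConst_ge
  have hS : (5713 / 4096 : ℝ) ≤ ∑ d ∈ Icc 1 D, fq 1 d * ((minResCount d K : ℝ) / (ord2 d : ℝ) ^ K) :=
    (singularMeanSum_five_ge hK).trans (singularMeanSum_mono hD)
  calc (0.918 : ℝ) ≤ 0.65828 * (5713 / 4096) := by norm_num
    _ ≤ twinPrimeConst * ∑ d ∈ Icc 1 D, fq 1 d * ((minResCount d K : ℝ) / (ord2 d : ℝ) ^ K) :=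
        mul_le_mul hC hS (by norm_num) (le_trans (by norm_num) hC)

/-- **Heath-Brown–Puchta's Theorem 1 inequality with the major-arc constant DEFINED, not quoted**: at `K = 13`,
`13.968 · 0.863665¹¹ < 2 Σ_{d ≤ 5} k(d) min_N H(d;N,13) ε(d)^{−13}` (the hypothesis `2.7895 ≤ C₃` of
`hbp_criterion_of_thirteen_le` discharged by `two_mul_singularMeanSum_five_ge`).  `K = 13` is Heath-Brown–Puchta's published
value; nothing is lowered. [cite: HeathbrownPuchta2002, Theorem 1, §5–§6] -/
theorem hbp_criterion_thirteen_definedMean :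
    (13.968 : ℝ) * 0.863665 ^ (13 - 2) < 2 * ∑ d ∈ Icc 1 5, fq 1 d * ((minResCount d 13 : ℝ) / (ord2 d : ℝ) ^ 13) :=
  lt_of_lt_of_le hbp_criterion_thirteen (two_mul_singularMeanSum_five_ge (by norm_num))

/-- The GRH line of Heath-Brown–Puchta (Theorem 2, `K = 7`, `λ = 0.722428`) with the major-arc constant defined:
`13.968 · 0.722428⁵ < 2 Σ_{d ≤ 5} k(d) min_N H(d;N,7) ε(d)^{−7}`.  GRH is NOT asserted; this is the arithmetic line only.
[cite: HeathbrownPuchta2002, Theorem 2, §5–§6] -/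
theorem hbp_criterion_GRH_seven_definedMean :
    (13.968 : ℝ) * 0.722428 ^ (7 - 2) < 2 * ∑ d ∈ Icc 1 5, fq 1 d * ((minResCount d 7 : ℝ) / (ord2 d : ℝ) ^ 7) :=
  lt_of_lt_of_le hbp_criterion_GRH_seven (two_mul_singularMeanSum_five_ge le_rfl)

/-! ### §3 Conclusion-form comparators: Liu–Lü's `2.8096` (`D = 11`) and Elsholtz's `2.96169` (`D = 21`) at `K ≥ 12` -/

/-- Certificate (seat 5's format `(d, prime factors, ξ(d), min_r resCount d 12 r)`) for the odd square-free `d ≤ 11`,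
`K = 12`. [folklore] -/
def cert12a : List (ℕ × List ℕ × ℕ × ℕ) :=
  [(1, [], 1, 1), (3, [3], 2, 1365), (5, [5], 4, 3355443), (7, [7], 3, 75900), (11, [11], 10, 90909090909)]

/-- Certificate entries `13 ≤ d ≤ 21`, `K = 12`. [folklore] -/
def cert12b : List (ℕ × List ℕ × ℕ × ℕ) :=
  [(13, [13], 12, 685853880635), (15, [3, 5], 4, 1116856), (17, [17], 8, 4042310155),
   (19, [19], 18, 60885862180325), (21, [3, 7], 6, 103603500)]

/-- The ten-entry certificate for `d ≤ 21`, `K = 12`. [folklore] -/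
def cert12 : List (ℕ × List ℕ × ℕ × ℕ) := cert12a ++ cert12b

set_option maxHeartbeats 40000000 in
/-- Kernel check of the `d ≤ 11` certificate against `D = 11`. [folklore] -/
theorem cert12a_ok : cert12a.all (certOK 12 11) = true := by
  decide +kernel

set_option maxHeartbeats 40000000 in
/-- Kernel check of the `d ≤ 11` certificate against `D = 21`. [folklore] -/
theorem cert12a_ok' : cert12a.all (certOK 12 21) = true := by
  decide +kernel

set_option maxHeartbeats 40000000 in
/-- Kernel check of the `13 ≤ d ≤ 21` entries against `D = 21`. [folklore] -/
theorem cert12b_ok : cert12b.all (certOK 12 21) = true := by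
  decide +kernel

/-- Kernel check of the full `d ≤ 21` certificate. [folklore] -/
theorem cert12_ok : cert12.all (certOK 12 21) = true := by
  simp only [cert12, List.all_append, cert12a_ok', cert12b_ok, Bool.and_self]

/-- Distinct moduli (`d ≤ 11`). [folklore] -/
theorem cert12a_nodup : (cert12a.map Prod.fst).Nodup := by decide

/-- Distinct moduli (`d ≤ 21`). [folklore] -/
theorem cert12_nodup : (cert12.map Prod.fst).Nodup := by decide

set_option maxHeartbeats 40000000 in
/-- Kernel evaluation in `ℚ`: `Σ_e certVal 12 e ≥ 1.438583` over `d ≤ 11` (exact: `1.4385834740…`). [folklore] -/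
theorem certSum12a_ge : (1438583 / 1000000 : ℚ) ≤ certSum 12 cert12a := by
  decide +kernel

set_option maxHeartbeats 40000000 in
/-- Kernel evaluation in `ℚ`: `Σ_e certVal 12 e ≥ 1.484302` over `d ≤ 21` (exact: `1.4843029064…`). [folklore] -/
theorem certSum12_ge : (1484302 / 1000000 : ℚ) ≤ certSum 12 cert12 := by
  decide +kernel

/-- `Σ_{1≤d≤11} k(d) minResCount d 12/ξ(d)^12 ≥ 1.438583`. [cite: HeathbrownPuchta2002, §4 (22)] -/
theorem singularMeanSum_eleven_twelve_ge :
    (1.438583 : ℝ) ≤ ∑ d ∈ Icc 1 11, fq 1 d * ((minResCount d 12 : ℝ) / (ord2 d : ℝ) ^ 12) := by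
  have h := certSum_le_sum 12 11 cert12a cert12a_ok cert12a_nodup
  have h2 : (((1438583 / 1000000 : ℚ)) : ℝ) ≤ ((certSum 12 cert12a : ℚ) : ℝ) := Rat.cast_le.2 certSum12a_ge
  have h3 : (((1438583 / 1000000 : ℚ)) : ℝ) = 1.438583 := by push_cast; norm_num
  linarith

/-- `Σ_{1≤d≤21} k(d) minResCount d 12/ξ(d)^12 ≥ 1.484302`. [cite: HeathbrownPuchta2002, §4 (22)] -/
theorem singularMeanSum_twentyOne_twelve_ge :
    (1.484302 : ℝ) ≤ ∑ d ∈ Icc 1 21, fq 1 d * ((minResCount d 12 : ℝ) / (ord2 d : ℝ) ^ 12) := by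
  have h := certSum_le_sum 12 21 cert12 cert12_ok cert12_nodup
  have h2 : (((1484302 / 1000000 : ℚ)) : ℝ) ≤ ((certSum 12 cert12 : ℚ) : ℝ) := Rat.cast_le.2 certSum12_ge
  have h3 : (((1484302 / 1000000 : ℚ)) : ℝ) = 1.484302 := by push_cast; norm_num
  linarith

/-- **Liu–Lü's printed `C₃ ≥ 2.8096` (`D = 11`) holds for the tree's truncated mean at every `K ≥ 12`** — indeed
`2 Σ_{d ≤ 11} ⋯ ≥ 2.877166` (conclusion form; Liu–Lü's own evaluation is not reproduced).
[cite: PlattTrudgian2015Linnik, §1 (Liu–Lü: C₃ ≥ 2.8096 with D = 11); HeathbrownPuchta2002, §4 (22)] -/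
theorem liuLu_majorArcConst_le_definedMean {K : ℕ} (hK : 12 ≤ K) :
    (2.8096 : ℝ) ≤ 2 * ∑ d ∈ Icc 1 11, fq 1 d * ((minResCount d K : ℝ) / (ord2 d : ℝ) ^ K) := by
  have h := singularMeanSum_eleven_twelve_ge.trans (singularMeanSum_mono_K (D := 11) (by norm_num) hK)
  linarith

/-- The sharper certified value: `2 Σ_{d ≤ 11} k(d) minResCount d K/ξ(d)^K ≥ 2.877166` for `K ≥ 12`.
[cite: HeathbrownPuchta2002, §4 (22)] -/
theorem two_mul_singularMeanSum_eleven_ge {K : ℕ} (hK : 12 ≤ K) :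
    (2.877166 : ℝ) ≤ 2 * ∑ d ∈ Icc 1 11, fq 1 d * ((minResCount d K : ℝ) / (ord2 d : ℝ) ^ K) := by
  have h := singularMeanSum_eleven_twelve_ge.trans (singularMeanSum_mono_K (D := 11) (by norm_num) hK)
  linarith

/-- **Elsholtz's `2.96169` (`D = 21`, reported in Heath-Brown–Puchta §1 and Platt–Trudgian §1) holds for the tree's
truncated mean at every `K ≥ 12`** — indeed `2 Σ_{d ≤ 21} ⋯ ≥ 2.968604` (conclusion form; Elsholtz's unpublished evaluation
is not reproduced). [cite: HeathbrownPuchta2002, §1 ("2.7895 in (25) to 2.96169, by using D = 21"); PlattTrudgian2015Linnik, §1] -/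
theorem elsholtz_majorArcConst_le_definedMean {K : ℕ} (hK : 12 ≤ K) :
    (2.96169 : ℝ) ≤ 2 * ∑ d ∈ Icc 1 21, fq 1 d * ((minResCount d K : ℝ) / (ord2 d : ℝ) ^ K) := by
  have h := singularMeanSum_twentyOne_twelve_ge.trans (singularMeanSum_mono_K (D := 21) (by norm_num) hK)
  linarith

/-- The sharper certified value: `2 Σ_{d ≤ 21} k(d) minResCount d K/ξ(d)^K ≥ 2.968604` for `K ≥ 12`.
[cite: HeathbrownPuchta2002, §4 (22)] -/
theorem two_mul_singularMeanSum_twentyOne_ge {K : ℕ} (hK : 12 ≤ K) :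
    (2.968604 : ℝ) ≤ 2 * ∑ d ∈ Icc 1 21, fq 1 d * ((minResCount d K : ℝ) / (ord2 d : ℝ) ^ K) := by
  have h := singularMeanSum_twentyOne_twelve_ge.trans (singularMeanSum_mono_K (D := 21) (by norm_num) hK)
  linarith

/-- In the tree's normalisation: `m_K(D) ≥ 0.977` for `K ≥ 12`, `D ≥ 21` (`1.484302 · 0.65828`).
[cite: HeathbrownPuchta2002, §4 (22)] -/
theorem mKD_ge_of_twelve_le {K D : ℕ} (hK : 12 ≤ K) (hD : 21 ≤ D) : (0.977 : ℝ) ≤ mKD K D := by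
  rw [mKD]
  have hC := twinPrimeConst_ge
  have hS : (1.484302 : ℝ) ≤ ∑ d ∈ Icc 1 D, fq 1 d * ((minResCount d K : ℝ) / (ord2 d : ℝ) ^ K) :=
    (singularMeanSum_twentyOne_twelve_ge.trans (singularMeanSum_mono_K (D := 21) (by norm_num) hK)).trans
      (singularMeanSum_mono hD)
  calc (0.977 : ℝ) ≤ 0.65828 * 1.484302 := by norm_num
    _ ≤ twinPrimeConst * ∑ d ∈ Icc 1 D, fq 1 d * ((minResCount d K : ℝ) / (ord2 d : ℝ) ^ K) :=
        mul_le_mul hC hS (by norm_num) (le_trans (by norm_num) hC)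

/-- **Liu–Lü's `K = 12` line (Platt–Trudgian's (12.98) rendering) with THEIR major-arc constant replaced by the defined
quantity**: for `C₂ ≤ 1.94`, `C₀ ≥ 0.6601618158`, `0 ≤ λ ≤ 0.862327`,
`λ¹⁰((7.8209 − 2)C₂ + (109/154) C₀⁻¹ log 2) < 2 Σ_{d ≤ 11} k(d) min_N H(d;N,12) ε(d)^{−12}` (`≤ 2.7365 < 2.8096 ≤ 2.8771`).
`K = 12` is Liu–Lü's published value; nothing is lowered; the sieve constant `7.8209` (Wu) and `λ` remain quoted inputs.
[cite: PlattTrudgian2015Linnik, §1, (12.98); LiuLu2011] -/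
theorem liuLu_criterion_twelve_definedMean {C0 C2 lam : ℝ} (hC2 : C2 ≤ 1.94) (hC2nn : 0 ≤ C2)
    (hC0 : 0.6601618158 ≤ C0) (hlam : lam ≤ 0.862327) (hlamnn : 0 ≤ lam) :
    lam ^ (12 - 2) * ((7.8209 - 2) * C2 + 109 / 154 * (Real.log 2 / C0)) <
      2 * ∑ d ∈ Icc 1 11, fq 1 d * ((minResCount d 12 : ℝ) / (ord2 d : ℝ) ^ 12) :=
  lt_of_lt_of_le (liuLu_criterion_twelve hC2 hC2nn hC0 hlam hlamnn) (liuLu_majorArcConst_le_definedMean le_rfl)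

end GoldbachLinnik

end Literature.NumberTheory.Sieve
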